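import Summits.NavierStokesRegularity.NavierStokesRegularity.Theorems.GaldiLiouvilleGateCriticalRateLiouvilleOfWu2026
import Summits.NavierStokesRegularity.NavierStokesRegularity.Theorems.SoloSalvageWu2026Reduced3
import Summits.NavierStokesRegularity.NavierStokesRegularity.Theorems.SoloSalvageWu2026StepConstruct
import HarnessLib

/-!
# Route `GaldiLiouvilleGate`, crux `CriticalRateLiouville` (item stmt-NavierStokesRegularity-0897)
# — CLOSED via W. Wu 2026 (cell `pub/ns-inputs`, A3; glue of record kits/A3.md §1′/§1⁗′)

With the four printed steps of Wu's proof discharged in the tree (`step_341`, `step_construct`,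
`step_P33`, `step_385`, namespace `…Theorems.Wu2026Salvage`), the reduced composition
`wu2026_critical_vorticity_liouville_of_step_construct` (`…SoloSalvageWu2026Reduced3`, seat wu-p33)
gives the Literature statement `Literature.Analysis.FluidPDE.Wu2026_critical_vorticity_liouville`
(critical-rate vorticity-decay Liouville theorem for steady D-solutions), and the route bridge
`GaldiLiouvilleGate.criticalRateLiouville_of_wu2026` turns it into the crux
`Theses.GaldiLiouvilleGate.CriticalRateLiouville`, typed literally.

Also recorded: the unconditional discharges of the Literature named facts `Wu2026_thm11`,
`Wu2026_cor12`, `Wu2026_critical_vorticity_liouville` (bare theorems here; a Literature `_holds`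
file cannot import `Summits/`).

Theorems only, standard axioms, no `sorry`.

WHAT THIS IS NOT: not a claim about NS regularity or blow-up — `CriticalRateLiouville` is a
Liouville statement for STEADY flows with critically decaying vorticity, one crux of one route; the
summit `NavierStokesRegularity` is untouched; not a claim about any author beyond the typed locator.
-/

set_option linter.dupNamespace false

noncomputable section

namespace Summit.NavierStokesRegularity.NavierStokesRegularity.Theorems.Wu2026Salvage

open Literature.Claims.NS.Wu2026

/-- **Wu 2026, Theorem 1.1** (Liouville theorem for steady D-solutions with critically decaying
vorticity), unconditional as typed. [cite: Wu2026, Thm. 1.1 p.2] -/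
theorem wu2026_thm11 : Literature.Analysis.FluidPDE.Wu2026_thm11 :=
  wu2026_thm11_of_step_construct step_construct

/-- **Wu 2026, Corollary 1.2**, unconditional as typed. [cite: Wu2026, Cor. 1.2 p.2] -/
theorem wu2026_cor12 : Literature.Analysis.FluidPDE.Wu2026_cor12 :=
  wu2026_cor12_of_step_construct step_construct

/-- **The critical-rate vorticity Liouville theorem** (Literature named fact
`Wu2026_critical_vorticity_liouville`), unconditional as typed. [cite: Wu2026, Thm. 1.1/Cor. 1.2 p.2] -/
theorem wu2026_critical_vorticity_liouville :
    Literature.Analysis.FluidPDE.Wu2026_critical_vorticity_liouville :=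
  wu2026_critical_vorticity_liouville_of_step_construct step_construct

/-- **Crux `CriticalRateLiouville` of route `GaldiLiouvilleGate`** (item
stmt-NavierStokesRegularity-0897), from Wu 2026 via the route bridge
`GaldiLiouvilleGate.criticalRateLiouville_of_wu2026`. [cite: Wu2026, Thm. 1.1 p.2] -/
theorem criticalRateLiouville_proof :
    Summit.NavierStokesRegularity.NavierStokesRegularity.Theses.GaldiLiouvilleGate.CriticalRateLiouville :=
  Theorems.GaldiLiouvilleGate.criticalRateLiouville_of_wu2026 wu2026_critical_vorticity_liouville

end Summit.NavierStokesRegularity.NavierStokesRegularity.Theorems.Wu2026Salvage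

end

-- WHAT THIS IS NOT: not a claim about NS regularity or blow-up; not a claim about any author beyond the typed locator.
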